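import Mathlib
import HarnessLib
import HarnessLib.Audit
import Summits.ABC.Statement
import Summits.ABC.ABC.Theorems.PlacewiseSzpiroSingleTowerSzpiroMersenneRadicalRungs
import Literature.NumberTheory.EllipticCurves.CongruenceNumber
import Literature.NumberTheory.EllipticCurves.PastenSpectralDegree
import Literature.NumberTheory.EllipticCurves.CuspFormTwist
import HarnessLib.Audit.Status.Attr

/-!
Route: TwistRigidExcess

# Route TwistRigidExcess — twist-rigid congruence numbers and the ceiling excess law feed the
congruence door of poly-Szpiro

It suffices to show X = ExcessCeiling ∧ TwistInvariance ∧ OrbitPolyDegree (door D-CONG of rung A-PS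
= `Summit.ABC.PolySzpiroRat`; NOT abc — POLY-SZPIRO(E); a first polynomial bound would supersede
Stewart–Yu's exponential). ExcessCeiling (deciding, killable): for an optimal datum at level N,
`2·ord_p(r_f) ≤ 2·ord_p(m_f) + ord_p(N) + 1` — Agashe–Ribet–Stein's Conj. 2.2 with the floor
replaced by the CEILING that the one-engine anomaly 1664 = 2⁷·13 (r/m = 2⁴ at the twist-minimal
members of each χ₋₄/χ₈-orbit, 2³ at their ±2-twists) demands. TwistInvariance (the
representation-theoretic reason, provable modulo one analytic input): at fixed level N with cond(χ)²
∣ N the congruence number is invariant under f ↦ f ⊗ χ (χ real primitive), because the twist is an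
integral Petersson-self-adjoint partial involution of S_k(Γ₀(N)); so r is constant on intra-level
twist orbits while m moves by |d| (Watkins), which is exactly the anomaly's shape. OrbitPolyDegree
is the DECLARED RESIDUAL (rung-strength, never staffed): each intra-level twist orbit of an optimal
newform contains a datum of polynomial degree (formally weaker than R1). The parts compose through
the R4 door with exponent K+1.
Lean: `Summit.ABC.ABC.Theses.TwistRigidExcess.ExcessCeiling ∧
Summit.ABC.ABC.Theses.TwistRigidExcess.TwistInvariance ∧
Summit.ABC.ABC.Theses.TwistRigidExcess.OrbitPolyDegree`

## Assembly
Pure logic through the support items: closes h₁ h₂ h₃ h₄ h₅ := h₄ h₃ h₁ h₂ h₅ (OrbitPropagation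
applied to the residual, the ceiling, the twist invariance and the known door facts); every binder
is load-bearing; no crux alone gives PolySzpiroRat (the residual is formally weaker than R1 and no
landed theorem takes it to A-PS; ExcessCeiling and TwistInvariance are statements about r_f/m_f and
say nothing about Δ_min).

CLOSES_TARGET: closes rung ABC-A-PS of ABC: Summit.ABC.PolySzpiroRat (D-0061; not the summit Statement) — the deciding theorem of this route concludes that registered leaf instead of the Statement decl `ABC` (class rung: servable and labelled, never counted as concluding the summit Statement).

Rationale: WHY THIS LINE. Mechanism (AgasheRibetStein2012 Lemma 5.5, Remark 5.3, Table 2): the excess r_E/m_E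
is the order of S/R with R = r_Eℤ ⊂ S = m_Eℤ, and S/R embeds in T₀/T, the saturation defect of the
Hecke ring inside End J₀(N) — invisible on q-expansions (T is saturated in End S₂(ℤ)), nonzero only
at p² ∣ N, and at 2⁷-levels of exponent 8 (N = 128: T₀/T = C2⊕C4⊕C8). New lever: the
level-preserving twist operator f ↦ f⊗χ for cond(χ)² ∣ N (Shimura1971 Prop. 3.64; tree `charTwist`,
q-expansion PROVED `cuspCoeff_charTwist`) is integral and Petersson-self-adjoint for real χ, hence
transports the congruence module of f onto that of f⊗χ: r is TWIST-RIGID at fixed level (computed ≠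
proved: 899/899 same-level twist pairs with N ≤ 2000 have equal r, 0 exceptions; calc/ticn_test.py
on the ENG-MSYM table), while m changes by |d|^(±1) (Watkins2002). Consequence: ARS Conj. 2.2 cannot
hold orbit-wise with the floor — the excess is maximal at the twist-minimal (discriminant- and
degree-minimal) member and exceeds ⌊e/2⌋ by the intra-orbit degree drop, which is what 1664 shows (r
= 1536, 1536, 2560 orbit-constant; m = 96/192, 96/192, 160/320). The line therefore files the
CEILING law as the killable deciding crux and the twist rigidity as its provable reason, and records
that the congruence door needs R1 only up to intra-level twisting. Imported: Atkin–Lehner–Li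
twisting theory (AtkinLi1978) and the T₀/T saturation module (AgasheRibetStein2012 §5) — neither is
used by any listed ABC route (IsogenyGlueCongruence: isogeny-class constancy of r and good
congruence primes; RibetTakahashiSplit / TamagawaTwistDictionary: Tamagawa products at
multiplicative primes; QuaternionicDegree / DefiniteXi: Jacquet–Langlands degrees); the negatives
index has no statement on r_f/m_f at p² ∣ N.

RANKED CRUXES. #2 ExcessCeiling (crux) — for every optimal (minimal-degree) modular parametrization
datum D at level N and every prime p, 2·ord_p(congruenceNumber D.f) ≤ 2·ord_p(D.modularDegree) +
ord_p(N) + 1, i.e. ord_p(r/m) ≤ ⌈ord_p(N)/2⌉ (ARS Conj. 2.2 with ceiling). [difficulty: L] (why it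
might fail: a 2-adic level deeper than the census (2⁸ ∣ N beyond N ≤ 2000, or 3⁵ ∣ N) with T₀/T of
exponent above 2^⌈e/2⌉ acting faithfully on S/R; 1664 itself is one-engine (DESK-CONG-1664-D/E
pending) and already sits ON the ceiling.) [AgasheRibetStein2012, Watkins2002, MurtyPasten2013]
#3 TwistInvariance (crux) — twist invariance of the congruence number at fixed level: if m² ∣ N, χ
is a primitive quadratic Dirichlet character mod m and f, g ∈ S_k(Γ₀(N)) satisfy aₙ(g) = χ(n)aₙ(f)
and aₙ(f) = χ(n)aₙ(g) for all n, then congruenceNumber g = congruenceNumber f. [difficulty: M] (why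
it might fail: Petersson self-adjointness of `charTwist` for real χ is not in the tree (sign =
χ(−1)·(Gauss-sum phase)² must be +1); if the sign were −1 on odd χ the transport still gives r_g =
r_f, but a non-scalar adjoint defect at 2-power conductors (χ₈ vs χ₋₈ mixing) would break the
quotient bijection.) [Shimura1971, AtkinLi1978, AgasheRibetStein2012]
#4 OrbitPolyDegree (crux) — DECLARED RESIDUAL (rung-strength; never staffed; not claimed easier than
R1 — AMPLIFICATION-NEUTRALITY): there are K, C such that for every optimal datum D at level N some
datum D' at level N whose newform is an admissible quadratic twist of D.f (coefficientwise by a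
primitive quadratic χ mod m, m² ∣ N, in both directions) has modularDegree ≤ C·N^K. [difficulty:
open-problem] (why it might fail: it is R1 (PolyModularDegreeRat) up to intra-level twisting, i.e.
poly-Szpiro-strength: false iff poly-Szpiro is false (e.g. an infinite family with log|Δ_min|/log N
→ ∞ such as hypothetical Masser-type record families beyond exponent 6K−3).) [MurtyPasten2013,
PastenShimura2024, Watkins2002]
#9 OrbitPropagation (support) — glue, provable now: OrbitPolyDegree → ExcessCeiling →
TwistInvariance → KnownDoorFacts → PolySzpiroRat. For any datum D pass to the optimal datum D₀ of
its class (`Pasten2024.exists_minimal_datum_in_class`), m₀ ∣ r₀ (Ribet), r₀ = r(D'.f) for the orbit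
member D' of the residual (twist invariance), r(D'.f) ≤ m(D'_opt)·N ≤ m(D')·N (ceiling summed over
p: ∏ p^⌈e_p/2⌉ ≤ N), so r_f ≤ C·N^(K+1) = R4 with exponent K+1; then the door
`Summit.ABC.Analytic.polySzpiroRat_of_polyCongruenceNumberRat` (adapt GlueCongruence l.241).
[difficulty: provable-now] [AgasheRibetStein2012, PastenShimura2024]
#9 KnownDoorFacts (support) — the three KNOWN named Literature facts the R4 ⇒ A-PS door takes as
hypotheses, as one item (precedent: ModularDatumExists / MazurKenkuBound of DefiniteXi,
ParsevalSymbolDictionary): modularity (`nonempty_modularParametrizationData`, Wiles–BCDT), Ribet's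
m_f ∣ r_f (`modularDegree_dvd_congruenceNumber`, ARS 2012 Thm 2.1), Mazur–Kenku
(`PastenShimura2024_minimalDegree_le_163_mul`). Cannot fail in print. [difficulty: provable-now]
[AgasheRibetStein2012, PastenShimura2024]

TWO-LAYER PLAN. ExcessCeiling ⇐ StubLowExponent (e_p ≤ 1: ARS Thm 2.1(b), tree fact
`padicValNat_congruenceNumber_eq_of_not_sq_dvd`) → StubTameSquare (e_p = 2, the only case with p ≥
5: excess ≤ 1) → StubWild (e_p ≥ 3 ⇒ p ∈ {2,3}: excess ≤ ⌈e_p/2⌉) → ExcessCeiling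
(bc/ExcessCeiling_birth.lean, kernel-checked). TwistInvariance ⇐ StubAdjoint (analytic: a ℂ-linear
coefficient-twisting operator on S_k(Γ₀(N)) that is Petersson-self-adjoint; `charTwist` supplies
everything but self-adjointness) → StubTransport (algebra: such a T with Tf = g, Tg = f induces
mutually inverse bijections of the congruence modules, T∘T ≡ id mod (ℤf)^⊥) → TwistInvariance
(bc/TwistInvariance_birth.lean, kernel-checked). Foreseen layer-2 for StubWild: the orbit reading —
excess(D) = excess(D_max-degree member) + ord_p of the degree drop, and ARS's floor law for the
degree-MAXIMAL orbit member.

KILL CRITERIA. A certified optimal newform with 2·ord_p(r_f/m_f) > ord_p(N) + 1 (two engines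
agreeing, e.g. DESK-CONG / ENG-MSYM-2ND excess column at N ≤ 10⁴, or Magma/Sage `congruence_number`
at a 2⁸- or 3⁵-level) closes the route `refuted:ExcessCeiling` — pivot: re-read the witness's twist
orbit; if the excess still equals ⌊e/2⌋ + (intra-orbit degree drop), re-file the ORBIT-MAX FLOOR law
as the deciding crux (new route, not a restatement). A same-level admissible twist pair (f, f⊗χ),
cond(χ)² ∣ N, with r_f ≠ r_(f⊗χ) refutes TwistInvariance and kills the mechanism outright (no
pivot). R1 `PolyModularDegreeRat` proved elsewhere moots the route (door closes A-PS directly); A-PS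
refuted moots it.

NOT DECOMPOSED YET. The e_p = 2 versus e_p ≥ 3 techniques (local Hecke algebra at p with U_p = 0 on
the p-new part; component groups and the Ling–Edixhoven description of T₀/T at p² ∣ N) are layer-2
children of ExcessCeiling; the Petersson adjoint of the slash-translation [1, u/m; 0, 1] (the one
analytic lemma under StubAdjoint) is a prover-attached lemma, not an item; the typed saturation
object T₀ = End(J₀(N)) ∩ (T ⊗ ℚ) is a definition request, not a crux (the tree has q-expansion
lattices and `anemicHeckeRing` only).

CHEAPEST FALSIFIER. Run the excess column 2·ord_p(r/m) − ord_p(N) − 1 ≤ 0 and the twist-pair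
equality r_E = r_(E⊗χ) over the existing ENG-MSYM / ENG-MSYM-2ND tables (N ≤ 3476, exact r_f on
1,910 + classes): done locally on the N ≤ 2000 table (calc/excess_law.py, calc/ticn_test.py,
seconds): 0 ceiling violations (max at (p,e) = (2,7): 4 = ⌈7/2⌉, N = 1664 only; every other (p,e)
cell ≤ ⌊e/2⌋), 899/899 twist pairs with equal r. Next cheapest: Sage `J0(N).congruence_number()` on
the six 1664 optimal curves by a second engine (desk jobs DESK-CONG-1664-D/E already queued by
abc-harv) and on N = 2⁸·5 = 1280, 2⁸·3 = 768·… levels ≤ 10⁴.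

NUMBERS. ARS 2012 Table 1/Table 2 (N ≤ 557): ord_2(r/m) ≤ 3 at 2⁷-levels in range? no 2⁷-level ≤ 557
except 128 (no curves), 256 (excess ≤ 2⁴? 256 = 2⁸: ceiling 4, ARS floor 4), 384 = 2⁷·3 (excess 2³ ≤
both); census N ≤ 2000 (ENG-MSYM-2ND, one engine at 1664): max ord_p(r/m) per (p, e): (2,2) 1, (2,3)
1, (2,4) 2, (2,5) 2, (2,6) 3, (2,7) 4 [1664 only; else 3], (2,8) 3, (3,2) 1, (3,3) 1, (3,4) 2, (3,5)
2, (5,2) 1, (7,2) 1, (11,2) 1, (13,2) 1; Stein 2000 web envelope ord_p(r/m) ≤ ord_p(N) − 1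
(MEMO-LIT-ARS22). R4 calibration (RequirementsCongruence §1): C = 1 ⇒ K ≥ 2.1776 (279366b1).
Exponent bookkeeping of this line: residual exponent K ⇒ R4 exponent K + 1 ⇒ A-PS exponent 6(K+1) −
3 + ε via the tree doors.

DEFINITION REQUESTS. HeckeSaturation (topic Summits/ABC/ABC/Theorems): T₀(N) := the saturation of
the weight-2 Hecke ring T ⊂ End S₂(Γ₀(N), ℂ) inside End(H₁(X₀(N), ℤ)) (equivalently End J₀(N) ∩ T ⊗
ℚ), with the finite module T₀/T and the ARS embedding S/R ↪ T₀/T (AgasheRibetStein2012 Lemma 5.5,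
Remark 5.3) — wanted to type the layer-2 children of ExcessCeiling («exponent of (T₀/T)_p ≤
p^⌈e_p/2⌉»). Cite fact wanted: Petersson self-adjointness of the twist f ↦ f⊗χ for real primitive χ
with cond(χ)² ∣ N (Shimura1971 Prop. 3.64 + adjoint of slash-translation; AtkinLi1978 §3).

Novelty: Searches (2026-08-28): lit search --hybrid "congruence number modular degree ratio conjecture ord_p
level"; lit search --hybrid "saturation of the Hecke algebra multiplicity one for differentials";
lit citing 10.1007/978-1-4614-1260-1_2 (30 citers, none at p² ∣ N; desk memo MEMO-LIT-ARS22 «in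
print: NO»); lit galaxy search "multiplicity one for differentials|congruence number of an
optimal|index of the Hecke algebra in" --star all (0), "congruence number|modular degree" --star pdf
(20, none relevant); lean search / rg over Summits/ABC + Literature (no twisting-vs-congruenceNumber
statement) — ERRATUM 03:2xZ: the cross-summit search over Summits/BirchSwinnertonDyer was NOT run
before filing; it finds the nearest prior art below (our own tree, 2026-08-27).
Nearest prior art found: IN TREE, cell bsd-f2-manin (BSD summit, 2026-08-27):
`Summit.BirchSwinnertonDyer.Rank1Residual.ManinAdditive.CongruenceExcessCeiling` (E-desc-19 = this
route's ExcessCeiling up to rendering; census v1.1 4555/4555; finding F-desc-ARS: 26 optimal curves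
with x₂ = 4 at v₂(N) = 7, three engines — ARS Conj. 2.2 refuted beyond print),
`SharpCongruenceCeiling` (E-desc-19♯), `TwistPacketCongruenceInvariance` (E-desc-20 = the
curve-level form of TwistInvariance, 707/707), `DyadicTypeTwoExcessFour` (E-desc-21: x₂ = 4 ⇔
Kodaira II at 2 ∧ E[2] irreducible), and the PROVED twin theorems
`O5.PrimeTwist.congruenceNumber_charTwist` (odd p),
`ManinAdditive.TwistAtTwo.congruenceNumber_charTwist_four/_eight` (with the P  [refs: 10.1007/978-1-4614-1260-1_2, AgasheRibetStein2012, Watkins2002]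

Barriers (technique_class: hecke-congruence-module, twist-operator, modular-degree-door): - technique_class: hecke-congruence-module, twist-operator, modular-degree-door
- Literature.Barriers.ABC (catalogue has no entry for the Hecke-congruence technique class; the
in-house walls that apply): AMPLIFICATION-NEUTRALITY (twisting cannot lower the Szpiro ratio of a
family) — honoured, not evaded: the residual OrbitPolyDegree is declared rung-strength and the line
claims no easing of R1 by twisting; the content is on the r-side (rigidity) not the Δ-side.
MURTY–PASTEN WALL (best unconditional log r_f ≤ (1/5)N log N, MurtyPasten2013 Thm 4.3): the line
does not attack log r_f ≪ log N directly; it isolates the p² ∣ N excess, where the wall is silent.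
B-CONG×HECKEDEG / Sturm–Murty partner census (DEAD SPLIT a): not used — no congruence partners are
counted; the transport is an explicit operator. Faltings-height equipartition over the Hecke
decomposition (DEAD SPLIT b) and CartanTruncation (DEAD SPLIT c): not used.
- Negatives index: empty at filing for statements about congruenceNumber / modularDegree at p² ∣ N
(ledger negatives --problem ABC, 2026-08-28); the line steers around the refuted sharp rows
(SharpCongruenceNumberRat-type K = 1 claims are abc-equivalent and not asserted: every exponent here
is existential).

Novelty grade: variant — critic abc-iut-crit-B g1: VARIANT = the same mechanism (twist-rigid congruence number at fixed level; excess ceiling x_p <= ceil(v_p(N)/2)) already typed and partly PROVED on this tree (BSD cell bsd-f2-manin: E-desc-19/20/21 conjectures 2026-08-27; twins O5.PrimeTwist.congruenceNumber_charTwist 2026 (refuter refuter-abc-iut-crit-B-g1-0, 2026-08-28T03:20:19Z; prior: Summit.BirchSwinnertonDyer.Rank1Residual.ManinAdditive.CongruenceExcessCeiling, Summit.BirchSwinnertonDyer.Rank1Residual.ManinAdditive.TwistPacketCongruenceInvariance, Summit.BirchSwinnertonDyer.Rank1Residual.ManinAdditive.DyadicTypeTwoExcessFour, Summit.BirchSwinnertonDyer.Rank1Residual.O5.PrimeTwist.congruenceNumber_charTwist,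 Summit.BirchSwinnertonDyer.Rank1Residual.ManinAdditive.TwistAtTwo.con)

History (route lifecycle, newest last):
- 2026-08-28T03:05:09Z · rev 1: restated KnownDoorFacts (stmt-ABC-25124) — restate KnownDoorFacts: inline the three fact BODIES (modularity, Ribet m|r, Mazur-Kenku) instead of the cite_only constants so the cone has no unproved Literat (planner-abc-idea-4-g0-0)

sub-problem: ABC · status: draft · opened planner-abc-idea-4-g0-0 2026-08-28T03:04:10Z · rev 2 · ledger route-ABC-TwistRigidExcess
GENERATED by the gate from the ledger (D-0016/17). Provers cite these decls: `theorem foo : Summit.ABC.ABC.Theses.TwistRigidExcess.<Decl> := …` in Summits/ABC/ABC/Theorems/<Name>.lean.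
-/

namespace Summit.ABC.ABC.Theses.TwistRigidExcess

open scoped BigOperators Topology Manifold Classical MeasureTheory ProbabilityTheory Matrix InnerProductSpace ComplexConjugate ContinuousMap
open Filter Set Function TopologicalSpace MeasureTheory

attribute [summit_statement] _root_.ABC
attribute [summit_statement] _root_.Summit.ABC.PolySzpiroRat

open Literature.Abc

/-- item stmt-ABC-25120 · crux · rank 2 · open · by planner
why it might fail: = BSD E-desc-19 ManinAdditive.CongruenceExcessCeiling up to rendering (census v1.1 4555/4555, N ≤ 2000; 26 curves with x₂ = 4 = ⌈7/2⌉ at v₂(N)=7, three engines); may fail at untested deep levels (2⁸·M, 3⁵·M) where T₀/T acts on S/R with larger exponent.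
sources: AgasheRibetStein2012, lean:Summit.BirchSwinnertonDyer.Rank1Residual.ManinAdditive.CongruenceExcessCeiling, lean:Summit.BirchSwinnertonDyer.Rank1Residual.ManinAdditive.SharpCongruenceCeiling, Watkins2002
[crux] for every optimal (minimal-degree) modular parametrization datum D at level N and every prime
p, 2·ord_p(congruenceNumber D.f) ≤ 2·ord_p(D.modularDegree) + ord_p(N) + 1, i.e. ord_p(r/m) ≤
⌈ord_p(N)/2⌉ (ARS Conj. 2.2 with ceiling). [difficulty: L] -/
@[route_item "route-ABC-TwistRigidExcess", crux]
def ExcessCeiling : Prop :=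
  ∀ (W : WeierstrassCurve ℚ) [W.IsElliptic] (N : ℕ) [NeZero N] (D : Literature.NumberTheory.EllipticCurves.ModularForms.ModularParametrizationData W N), (∀ (W' : WeierstrassCurve ℚ) [W'.IsElliptic] (D' : Literature.NumberTheory.EllipticCurves.ModularForms.ModularParametrizationData W' N), D'.f = D.f → D.modularDegree ≤ D'.modularDegree) → ∀ p : ℕ, p.Prime → 2 * padicValNat p (Literature.NumberTheory.EllipticCurves.ModularForms.congruenceNumber D.f) ≤ 2 * padicValNat p D.modularDegree + padicValNat p N + 1

/-- item stmt-ABC-25122 · crux · rank 4 · open · by planner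
why it might fail: DECLARED RESIDUAL: R1 (PolyModularDegreeRat) up to intra-level twisting = poly-Szpiro strength; false iff poly-Szpiro fails; not claimed easier (AMPLIFICATION-NEUTRALITY).
sources: MurtyPasten2013, PastenShimura2024
[crux] DECLARED RESIDUAL (rung-strength; never staffed; not claimed easier than R1 —
AMPLIFICATION-NEUTRALITY): there are K, C such that for every optimal datum D at level N some datum
D' at level N whose newform is an admissible quadratic twist of D.f (coefficientwise by a primitive
quadratic χ mod m, m² ∣ N, in both directions) has modularDegree ≤ C·N^K. [difficulty: open-problem] -/
@[route_item "route-ABC-TwistRigidExcess", crux]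
def OrbitPolyDegree : Prop :=
  ∃ K C : ℝ, ∀ (W : WeierstrassCurve ℚ) [W.IsElliptic] (N : ℕ) [NeZero N] (D : Literature.NumberTheory.EllipticCurves.ModularForms.ModularParametrizationData W N), (∀ (W' : WeierstrassCurve ℚ) [W'.IsElliptic] (D' : Literature.NumberTheory.EllipticCurves.ModularForms.ModularParametrizationData W' N), D'.f = D.f → D.modularDegree ≤ D'.modularDegree) → ∃ (W' : WeierstrassCurve ℚ) (_ : W'.IsElliptic) (D' : Literature.NumberTheory.EllipticCurves.ModularForms.ModularParametrizationData W' N) (m : ℕ) (_ : NeZero m) (χ : DirichletCharacter ℂ m), m ^ 2 ∣ N ∧ χ.IsPrimitive ∧ MulChar.IsQuadratic χ ∧ (∀ n : ℕ, Literature.NumberTheory.EllipticCurves.ModularForms.cuspCoeff D'.f n = χ n * Literature.NumberTheory.EllipticCurves.ModularForms.cuspCoeff D.f n) ∧ (∀ n : ℕ, Literature.NumberTheory.EllipticCurves.ModularForms.cuspCoeff D.f n = χ n * Literature.NumberTheory.EllipticCurves.ModularForms.cuspCoeff D'.f n) ∧ (D'.modularDegree : ℝ) ≤ C * (N : ℝ)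 ^ K

/-- item stmt-ABC-25121 · support · rank 3 · open · by planner
why it might fail: Petersson self-adjointness of `charTwist` for real χ is not in the tree (sign = χ(−1)·(Gauss-sum phase)² must be +1); if the sign were −1 on odd χ the transport still gives r_g = r_f, but a non-scalar adjoint defect at 2-power conductors (χ₈ vs χ₋₈ mixing) would break the quotient bijection.
sources: AgasheRibetStein2012, Shimura1971, lean:Summit.BirchSwinnertonDyer.Rank1Residual.O5.PrimeTwist.congruenceNumber_charTwist, lean:Summit.BirchSwinnertonDyer.Rank1Residual.ManinAdditive.TwistAtTwo.congruenceNumber_charTwist_four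
[crux] twist invariance of the congruence number at fixed level: if m² ∣ N, χ is a primitive
quadratic Dirichlet character mod m and f, g ∈ S_k(Γ₀(N)) satisfy aₙ(g) = χ(n)aₙ(f) and aₙ(f) =
χ(n)aₙ(g) for all n, then congruenceNumber g = congruenceNumber f. [difficulty: M] -/
@[route_item "route-ABC-TwistRigidExcess", crux]
def TwistInvariance : Prop :=
  ∀ (N : ℕ) [NeZero N] (k : ℤ) (m : ℕ) [NeZero m], m ^ 2 ∣ N → ∀ (χ : DirichletCharacter ℂ m), χ.IsPrimitive → MulChar.IsQuadratic χ → ∀ f g : CuspForm (CongruenceSubgroup.Gamma0 N) k, (∀ n : ℕ, Literature.NumberTheory.EllipticCurves.ModularForms.cuspCoeff g n = χ n * Literature.NumberTheory.EllipticCurves.ModularForms.cuspCoeff f n) → (∀ n : ℕ, Literature.NumberTheory.EllipticCurves.ModularForms.cuspCoeff f n = χ n * Literature.NumberTheory.EllipticCurves.ModularForms.cuspCoeff g n) → Literature.NumberTheory.EllipticCurves.ModularForms.congruenceNumber g = Literature.NumberTheory.EllipticCurves.ModularForms.congruenceNumber f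

-- earlier KnownDoorFacts (stmt-ABC-25124, replaced 2026-08-28T03:05:09Z -> stmt-ABC-25129): retired by None — Literature.NumberTheory.EllipticCurves.ModularForms.nonempty_modularParametrizationData ∧ Literature.NumberTheory.EllipticCurves.ModularForms.modularDegree_dvd_congruenceNumber ∧ Literature.NumberTheory.EllipticCurves.ModularForms.PastenShimura2024_minimalDegree_le_163_mul
/-- item stmt-ABC-25129 · support · rank 9 · open · by planner
sources: AgasheRibetStein2012, PastenShimura2024
[support] the three KNOWN named Literature facts the R4 ⇒ A-PS door takes as hypotheses, as one item
(precedent: ModularDatumExists / MazurKenkuBound of DefiniteXi, ParsevalSymbolDictionary):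
modularity (`nonempty_modularParametrizationData`, Wiles–BCDT), Ribet's m_f ∣ r_f
(`modularDegree_dvd_congruenceNumber`, ARS 2012 Thm 2.1), Mazur–Kenku
(`PastenShimura2024_minimalDegree_le_163_mul`). Cannot fail in print. [difficulty: provable-now] -/
@[route_item "route-ABC-TwistRigidExcess", crux]
def KnownDoorFacts : Prop :=
  (∀ (W : WeierstrassCurve ℚ) [W.IsElliptic] [W.IsGloballyMinimal] [NeZero (W.conductorNorm ℤ)], Nonempty (Literature.NumberTheory.EllipticCurves.ModularForms.ModularParametrizationData W (W.conductorNorm ℤ))) ∧ (∀ (W : WeierstrassCurve ℚ) [W.IsElliptic] (N : ℕ) [NeZero N] (D : Literature.NumberTheory.EllipticCurves.ModularForms.ModularParametrizationData W N), (∀ (W' : WeierstrassCurve ℚ) [W'.IsElliptic] (D' : Literature.NumberTheory.EllipticCurves.ModularForms.ModularParametrizationData W' N), D'.f = D.f → D.modularDegree ≤ D'.modularDegree) → D.modularDegree ∣ Literature.NumberTheory.EllipticCurves.ModularForms.congruenceNumber D.f) ∧ (∀ (N : ℕ) [NeZero N] (W W' : WeierstrassCurve ℚ) [W.IsElliptic]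 [W'.IsElliptic] [W'.IsGloballyMinimal] (D : Literature.NumberTheory.EllipticCurves.ModularForms.ModularParametrizationData W N) (D' : Literature.NumberTheory.EllipticCurves.ModularForms.ModularParametrizationData W' N), D'.f = D.f → (∀ (W'' : WeierstrassCurve ℚ) [W''.IsElliptic] (D'' : Literature.NumberTheory.EllipticCurves.ModularForms.ModularParametrizationData W'' N), D''.f = D.f → D.modularDegree ≤ D''.modularDegree) → (∀ D'' : Literature.NumberTheory.EllipticCurves.ModularForms.ModularParametrizationData W' N, D'.modularDegree ≤ D''.modularDegree) → D'.modularDegree ≤ 163 * D.modularDegree)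

/-- item stmt-ABC-25123 · support · rank 9 · open · by planner
sources: AgasheRibetStein2012, PastenShimura2024
[support] glue, provable now: OrbitPolyDegree → ExcessCeiling → TwistInvariance → KnownDoorFacts →
PolySzpiroRat. For any datum D pass to the optimal datum D₀ of its class
(`Pasten2024.exists_minimal_datum_in_class`), m₀ ∣ r₀ (Ribet), r₀ = r(D'.f) for the orbit member D'
of the residual (twist invariance), r(D'.f) ≤ m(D'_opt)·N ≤ m(D')·N (ceiling summed over p: ∏
p^⌈e_p/2⌉ ≤ N), so r_f ≤ C·N^(K+1) = R4 with exponent K+1; then the door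
`Summit.ABC.Analytic.polySzpiroRat_of_polyCongruenceNumberRat` (adapt GlueCongruence l.241).
[difficulty: provable-now] -/
@[route_item "route-ABC-TwistRigidExcess", crux]
def OrbitPropagation : Prop :=
  OrbitPolyDegree → ExcessCeiling → TwistInvariance → KnownDoorFacts → Summit.ABC.PolySzpiroRat

/-- item stmt-ABC-25125 · assembly · rank 1 · open · by planner
sources: AgasheRibetStein2012
[assembly] ExcessCeiling → TwistInvariance → OrbitPolyDegree → OrbitPropagation → KnownDoorFacts →
PolySzpiroRat. -/
@[route_item "route-ABC-TwistRigidExcess"]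
def Assembly : Prop :=
  Summit.ABC.ABC.Theses.TwistRigidExcess.ExcessCeiling → Summit.ABC.ABC.Theses.TwistRigidExcess.TwistInvariance → Summit.ABC.ABC.Theses.TwistRigidExcess.OrbitPolyDegree → Summit.ABC.ABC.Theses.TwistRigidExcess.OrbitPropagation → Summit.ABC.ABC.Theses.TwistRigidExcess.KnownDoorFacts → Summit.ABC.PolySzpiroRat

/-! D-0027 §2.1 — DECIDING THEOREM (planner-authored via `route open/edit --closes-file`; by planner-abc-idea-4-g0-0 2026-08-28T03:04:10Z):
its hypotheses are this route's items and its conclusion the registered leaf `Summit.ABC.PolySzpiroRat` (rung ABC-A-PS, D-0061) (glue_lint), and it elaborates with this file. -/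

@[closes "route-ABC-TwistRigidExcess"] theorem closes (h₁ : ExcessCeiling) (h₂ : TwistInvariance) (h₃ : OrbitPolyDegree)
    (h₄ : OrbitPropagation) (h₅ : KnownDoorFacts) : Summit.ABC.PolySzpiroRat :=
  h₄ h₃ h₁ h₂ h₅

end Summit.ABC.ABC.Theses.TwistRigidExcess
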